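import Summits.AtomisticToContinuum.Crystallization.Theorems.ChargedEnergyGapRegistryRigidity
import Summits.AtomisticToContinuum.Crystallization.Theorems.ChargedEnergyGapAffineStabilityFccClass
import HarnessLib

/-!
# Charged energy gap — lens-3 g67, «FccScaleNumerics»: the (U-f) certificate `FccStressFreeScale` REDUCED to two explicit `ℤ³` sums of `(a, h)`

Cell `decomp-a2c`, seat lens-3, generation 67, part P-N⁗·d (over «RegistryRigidity» `…Theorems.ChargedEnergyGapRegistryRigidity` and the §S5 class
glue `…Theorems.ChargedEnergyGapAffineStabilityFccClass`; same namespace as both).  ELEMENTARY·PROVED; complete (no placeholders); standard axioms.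

WHAT IT DOES.  (U-f) `Fcc.FccStressFreeScale` — «a site-stress-free periodic presentation of an isometric image of `fccStacking a h`, `(a, h)` in the
Barlow window, has `h = hOf a` and `bOf a = a0`» — is the one certificate left under the CLASS-LEVEL affine stability [A-i]ᶠ
(`Fcc.sitewiseAffineStability_fccClass_of_scale`).  As typed it quantifies over periodic configurations `P`, isometries `g` and the site-virial `tsum` over
the subtype `{z ∈ P.points, z ≠ y}` — not a shape an interval certificate can consume.  Here it is reduced to a statement about TWO EXPLICIT REAL FUNCTIONS of
`(a, h)`, each a `tsum` over `ℤ³` of a closed-form summand (no `P`, no `g`, no subtype):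
* `virialTerm00 a h s m i₀ j₀` — the `ℤ³` family of the IN-PLANE (`e₀e₀`) site virial of `barlowStacking a h s` at the site `barlowPos m i₀ j₀` (companion of
  «RegistryRigidity»'s normal–normal family `virialTermNN`), with ★ `siteVirial_barlow00_eq_tsum` (pull-back along the rigid motion + `ℤ³` re-indexing, for
  EVERY word `s`, exactly as `siteVirial_barlow_eq_tsum`);
* `Fcc.fccVirialNN a h := Σ'_t virialTermNN a h constHagg 0 0 0 t` and `Fcc.fccVirial00 a h := Σ'_t virialTerm00 a h constHagg 0 0 0 t` — the normal and the
  in-plane site virial of the rhombohedral `ABC` family at its base site, as functions of `(a, h)` alone (`haggLabel constHagg k = k`, so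
  `barlowPos a h constHagg k i j = i•u + j•v + k•w + k•h e₃`: the summands are rational functions of `a`, `h` and `‖·‖`);
* ★ `Fcc.FccScaleNumerics` — TYPED census target: on the window, `fccVirialNN a h = 0 → fccVirial00 a h = 0 → h = hOf a ∧ bOf a = a0` (the common zero of two
  explicit lattice sums in the window is the ideal-ratio, stress-free-scale point; floats memo g67 §8: unique root `(a₀√2, a₀√2·√(2/3)) ≈ (0.97132, 0.79308)`,
  Jacobian `det ≈ 820`, exterior margin `min max(|T∥|, |T⊥|) ≈ 0.54` — O(1) quantities, 10⁻³ resolution suffices: direct sums + polynomial tails, unlike [DOM]);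
* ★★ `Fcc.fccStressFreeScale_of_numerics : FccScaleNumerics → FccStressFreeScale` — PROVED (rigid-motion presentation `Fcc.exists_linearIsometryEquiv_of_isometry`,
  site-stress-freeness at every point `IsSiteStressFree.siteVirial_eq_zero`, the two pull-back identities at the base site `barlowPos 0 0 0`).
Hence CLASS-LEVEL [A-i]ᶠ ⟸ `FccScaleNumerics` ALONE: ★★ `Fcc.sitewiseAffineStability_fccClass_of_numerics`.

NOT claimed: `FccScaleNumerics` itself (CERT, census ⑥″); nothing about hcp ((U-h)/STAB-h are the analogous statements over `alternatingHagg`, whose base-site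
virial is NOT site-independent in the same trivial way but is by the glide symmetry — left to g68).
-/

open scoped Classical
open Literature.MathematicalPhysics.StatisticalMechanics Literature.Geometry.DiscreteGeometry
open Summit.AtomisticToContinuum.Crystallization.Theses.PricedLinkCensus
open Summit.AtomisticToContinuum.Crystallization.Theorems.ChargedEnergyGapNegative

namespace Summit.AtomisticToContinuum.Crystallization.Theorems.ChargedEnergyGapChartDial

variable {P : PeriodicConfiguration 3}

/-! ## §N1 The in-plane (`e₀e₀`) site-virial family over `ℤ³` and its pull-back identity (every word) -/

section InPlane

/-- The first basis vector as a coordinate functional: `⟪x, e₀⟫ = x₀` with `e₀ = EuclideanSpace.single 0 1`. -/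
theorem inner_single_zero (x : E3) : inner ℝ x (EuclideanSpace.single (0 : Fin 3) (1 : ℝ)) = x 0 := by
  rw [EuclideanSpace.inner_single_right]
  simp

/-- THE `ℤ³` FAMILY of the in-plane (`e₀e₀`) site virial of `barlowStacking a h s` at the site `barlowPos m i₀ j₀`:
`T₀₀(k, i, j) = φ(‖z − y‖)·(z − y)₀²`, `φ(r) = V′(r)/r`, `z = barlowPos k i j`, `y = barlowPos m i₀ j₀`. -/
noncomputable def virialTerm00 (a h : ℝ) (s : ℤ → ℤ) (m i₀ j₀ : ℤ) (t : ℤ × ℤ × ℤ) : ℝ :=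
  ljD1 ‖barlowPos a h s t.1 t.2.1 t.2.2 - barlowPos a h s m i₀ j₀‖ / ‖barlowPos a h s t.1 t.2.1 t.2.2 - barlowPos a h s m i₀ j₀‖ *
    ((barlowPos a h s t.1 t.2.1 t.2.2 - barlowPos a h s m i₀ j₀) 0 * (barlowPos a h s t.1 t.2.1 t.2.2 - barlowPos a h s m i₀ j₀) 0)

/-- ★ The in-plane site virial of a rigid Barlow presentation at a lattice site IS the `ℤ³` sum of `virialTerm00` (companion of `siteVirial_barlow_eq_tsum`). -/
theorem siteVirial_barlow00_eq_tsum {a h : ℝ} {s : ℤ → ℤ} (L : E3 ≃ₗᵢ[ℝ] E3) (c : E3) (ha : 0 < a) (hh : 0 < h)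
    (hP : P.points = (fun x => L x + c) '' barlowStacking a h s) (m i₀ j₀ : ℤ) :
    siteVirial P (L (barlowPos a h s m i₀ j₀) + c) (L (EuclideanSpace.single (0 : Fin 3) (1 : ℝ))) (L (EuclideanSpace.single (0 : Fin 3) (1 : ℝ))) =
      ∑' t : ℤ × ℤ × ℤ, virialTerm00 a h s m i₀ j₀ t := by
  rw [siteVirial_presentation L c hP]
  rw [tsum_barlowStacking_punctured ha hh s m i₀ j₀
    (fun w => ljD1 (dist (barlowPos a h s m i₀ j₀) w) / dist (barlowPos a h s m i₀ j₀) w *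
      (inner ℝ (w - barlowPos a h s m i₀ j₀) (EuclideanSpace.single (0 : Fin 3) (1 : ℝ)) *
        inner ℝ (w - barlowPos a h s m i₀ j₀) (EuclideanSpace.single (0 : Fin 3) (1 : ℝ)))) (by simp)]
  refine tsum_congr fun t => ?_
  simp only [virialTerm00, inner_single_zero, dist_eq_norm']

end InPlane

namespace Fcc

/-! ## §N2 The two explicit functions of `(a, h)` and the TYPED census target `FccScaleNumerics` -/

/-- The NORMAL (`e₃e₃`) site virial of the rhombohedral `ABC` family `fccStacking a h` at its base site, as an explicit `ℤ³` sum. -/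
noncomputable def fccVirialNN (a h : ℝ) : ℝ :=
  ∑' t : ℤ × ℤ × ℤ, virialTermNN a h constHagg 0 0 0 t

/-- The IN-PLANE (`e₀e₀`) site virial of `fccStacking a h` at its base site, as an explicit `ℤ³` sum. -/
noncomputable def fccVirial00 (a h : ℝ) : ℝ :=
  ∑' t : ℤ × ℤ × ℤ, virialTerm00 a h constHagg 0 0 0 t

/-- The summand of `fccVirialNN`, fully explicit: with `p = i•u + j•v + k•w + k•(h e₃)` (`u, v` the triangular basis, `w` the Barlow offset),
`virialTermNN a h constHagg 0 0 0 (k, i, j) = (V′(‖p‖)/‖p‖)·(k h)²`. -/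
theorem virialTermNN_constHagg_base (a h : ℝ) (t : ℤ × ℤ × ℤ) :
    virialTermNN a h constHagg 0 0 0 t =
      ljD1 ‖(t.2.1 : ℝ) • triangularVec₁ a + (t.2.2 : ℝ) • triangularVec₂ a + (t.1 : ℝ) • barlowOffset a + (t.1 : ℝ) • layerNormal h‖ /
        ‖(t.2.1 : ℝ) • triangularVec₁ a + (t.2.2 : ℝ) • triangularVec₂ a + (t.1 : ℝ) • barlowOffset a + (t.1 : ℝ) • layerNormal h‖ *
        (((t.1 : ℝ) * h) * ((t.1 : ℝ) * h)) := by
  have hp : barlowPos a h constHagg t.1 t.2.1 t.2.2 - barlowPos a h constHagg 0 0 0 =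
      (t.2.1 : ℝ) • triangularVec₁ a + (t.2.2 : ℝ) • triangularVec₂ a + (t.1 : ℝ) • barlowOffset a + (t.1 : ℝ) • layerNormal h := by
    simp [barlowPos, haggLabel_const]
  simp only [virialTermNN, hp, Int.cast_zero, sub_zero]

/-- The summand of `fccVirial00`, fully explicit (same `p`): `virialTerm00 a h constHagg 0 0 0 (k, i, j) = (V′(‖p‖)/‖p‖)·p₀²`. -/
theorem virialTerm00_constHagg_base (a h : ℝ) (t : ℤ × ℤ × ℤ) :
    virialTerm00 a h constHagg 0 0 0 t =
      ljD1 ‖(t.2.1 : ℝ) • triangularVec₁ a + (t.2.2 : ℝ) • triangularVec₂ a + (t.1 : ℝ) • barlowOffset a + (t.1 : ℝ) • layerNormal h‖ /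
        ‖(t.2.1 : ℝ) • triangularVec₁ a + (t.2.2 : ℝ) • triangularVec₂ a + (t.1 : ℝ) • barlowOffset a + (t.1 : ℝ) • layerNormal h‖ *
        (((t.2.1 : ℝ) • triangularVec₁ a + (t.2.2 : ℝ) • triangularVec₂ a + (t.1 : ℝ) • barlowOffset a + (t.1 : ℝ) • layerNormal h) 0 *
          ((t.2.1 : ℝ) • triangularVec₁ a + (t.2.2 : ℝ) • triangularVec₂ a + (t.1 : ℝ) • barlowOffset a + (t.1 : ℝ) • layerNormal h) 0) := by
  have hp : barlowPos a h constHagg t.1 t.2.1 t.2.2 - barlowPos a h constHagg 0 0 0 =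
      (t.2.1 : ℝ) • triangularVec₁ a + (t.2.2 : ℝ) • triangularVec₂ a + (t.1 : ℝ) • barlowOffset a + (t.1 : ℝ) • layerNormal h := by
    simp [barlowPos, haggLabel_const]
  simp only [virialTerm00, hp]

/-- ★ piece (U-f)-num · UNDECIDED · TRUE-leaning · CERT-able · **THE (U-f) CERTIFICATE IN CENSUS FORM**: on the Barlow window, the common zero of the two
explicit lattice sums `fccVirialNN a h` (normal site virial) and `fccVirial00 a h` (in-plane site virial) of the rhombohedral `ABC` family is the
ideal-ratio, stress-free-scale point: `h = hOf a = a√(2/3)` and `bOf a = a/√2 = a₀`.  Floats (memo g67 §8): unique root `(a, h) ≈ (0.971317, 0.793077)`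
= `(a₀√2, a₀√2·√(2/3))`, Jacobian `det ≈ 820`, exterior margin `≈ 0.54`; O(1) sums, 10⁻³ resolution — direct truncation + polynomial tails suffice.
Why it might fail: only through a second common zero inside the window (none numerically). -/
def FccScaleNumerics : Prop :=
  ∀ a h : ℝ, 9 / 10 ≤ a → a ≤ 11 / 10 → 0 < h → 27 / 50 * a ^ 2 ≤ h ^ 2 → h ^ 2 ≤ 121 / 150 * a ^ 2 →
    fccVirialNN a h = 0 → fccVirial00 a h = 0 → h = hOf a ∧ bOf a = a0

/-! ## §N3 ★★ (U-f) ⟸ (U-f)-num PROVED, and the class-level [A-i]ᶠ beneath it -/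

/-- ★★ **(U-f) FROM ITS CENSUS FORM**: `FccScaleNumerics → FccStressFreeScale`.  Present the isometry as a rigid motion `x ↦ L x + c`; the base site
`L (barlowPos 0 0 0) + c` is a point of `P`, so both its normal and its in-plane site virial vanish (`IsSiteStressFree.siteVirial_eq_zero`); by the two
pull-back identities these ARE `fccVirialNN a h` and `fccVirial00 a h`. -/
theorem fccStressFreeScale_of_numerics (hN : FccScaleNumerics) : FccStressFreeScale := by
  intro P a h g ha hh hg hP hS
  obtain ⟨L, c, hLc⟩ := exists_linearIsometryEquiv_of_isometry hg
  have ha0 : 0 < a := by linarith [ha.1]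
  have hg' : g = fun x => L x + c := funext hLc
  have hP' : P.points = (fun x => L x + c) '' barlowStacking a h constHagg := by rw [hP, hg']; rfl
  have hy : L (barlowPos a h constHagg 0 0 0) + c ∈ P.points := by
    rw [hP']
    exact ⟨_, barlowPos_mem 0 0 0, rfl⟩
  have h1 := hS.siteVirial_eq_zero hy (L (layerNormal 1)) (L (layerNormal 1))
  rw [siteVirial_barlow_eq_tsum L c ha0 hh.1 hP' 0 0 0] at h1
  have h2 := hS.siteVirial_eq_zero hy (L (EuclideanSpace.single (0 : Fin 3) (1 : ℝ))) (L (EuclideanSpace.single (0 : Fin 3) (1 : ℝ)))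
  rw [siteVirial_barlow00_eq_tsum L c ha0 hh.1 hP' 0 0 0] at h2
  exact hN a h ha.1 ha.2 hh.1 hh.2.1 hh.2.2 h1 h2

/-- ★★ CLASS-LEVEL [A-i]ᶠ MODULO THE CENSUS FORM: given `FccScaleNumerics`, every site-stress-free periodic presentation of an fcc-class Barlow image (constant
word, window) satisfies the sitewise affine stability inequality with `κ = 3/8` at every point (`sitewiseAffineStability_fccClass_of_scale` ∘
`fccStressFreeScale_of_numerics`). -/
theorem sitewiseAffineStability_fccClass_of_numerics (hN : FccScaleNumerics) (P : PeriodicConfiguration 3) {a h : ℝ} {s : ℤ → ℤ} {g : E3 → E3}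
    (ha : 9 / 10 ≤ a ∧ a ≤ 11 / 10) (hh : 0 < h ∧ 27 / 50 * a ^ 2 ≤ h ^ 2 ∧ h ^ 2 ≤ 121 / 150 * a ^ 2) (hH : IsHaggSeq s) (hs : ∀ i, s (i + 1) = s i)
    (hg : Isometry g) (hP : P.points = g '' barlowStacking a h s) (hS : IsSiteStressFree P) :
    ∀ y ∈ P.points, ∀ (A : E3 →ₗ[ℝ] E3) (u : E3), ‖u‖ = 1 → (3 / 8) * inner ℝ u (A u) ^ 2 ≤ quadSite (affineField A) P ∅ y :=
  sitewiseAffineStability_fccClass_of_scale (fccStressFreeScale_of_numerics hN) P ha hh hH hs hg hP hS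

end Fcc

end Summit.AtomisticToContinuum.Crystallization.Theorems.ChargedEnergyGapChartDial
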